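import Literature.Computability.Cryptography.LWENoiseWidth
import Literature.Probability.Distributions.IndepProductLawDistance
import HarnessLib

/-!
# From an unknown noise rate `β ≤ α` to the rate `α`: the grid step of Regev 2009, Lemma 3.7 (distributional part)

Topic `Computability/Cryptography` (LWE noise), grouping namespace `LWE`; sequel of `LWENoiseWidth.lean`
(Regev 2009, Claim 2.2: `Δ(Ψ̄_a, Ψ̄_b) ≤ 2(b/a - 1)` for `0 < a ≤ b ≤ 2a`). Proved material (no named fact)
towards pqc.S19–S21: the analytic content of the normalisation of an `LWE` oracle for an unknown noise
rate (`LWE_{q,≤α}` / "some `β ≤ α`") to the fixed rate `α` — Regev 2009, Lemma 3.7 (search, used inside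
Lemma 3.4 = pqc.S19/S20's cores), BLPRS 2013, Lemma 2.15 (decision, used by hypothesis `h₃` of
`BLPRSReduction.lean`, pqc.S21; "The proof is standard (see, e.g., [Regev 2009])"):

> **Lemma 3.7** (Regev 2009, proof). *"Let `Z` be the set of all integer multiplies of `n^{-2c} α²`
> between `0` and `α²`. For each `γ ∈ Z`, … adds to the second element of each sample a noise sampled
> independently from `Ψ_{√γ}`. This creates `nᶜ` samples taken from the distribution `A_{s,Ψ_{√(β²+γ)}}`. …
> Consider the smallest `γ ∈ Z` such that `γ ≥ α² - β²`. Clearly, `γ ≤ α² - β² + n^{-2c}α²`. Define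
> `α' = √(β² + γ)`. Then `α ≤ α' ≤ √(α² + n^{-2c}α²) ≤ (1 + n^{-2c})α`. By Claim 2.2, the statistical
> distance between `Ψ_α` and `Ψ_{α'}` is at most `9n^{-2c}`. Hence, the statistical distance between `nᶜ`
> samples from `Ψ_α` and `nᶜ` samples from `Ψ_{α'}` is at most `9n^{-c}`."*

## Results (grid of `N + 1` points `γ_j = j α²/N`, `N ≥ 1`; rates `gridRate α β N j = √(β² + j α²/N)`)

* `exists_gridRate_between` — **the printed grid step**: for `0 < β ≤ α` there is `j ≤ N` with
  `α ≤ √(β² + jα²/N) ≤ (1 + 1/N) α` (the smallest `j` with `β² + jα²/N ≥ α²`);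
* `tvDist_lweSample_le_tvDist`, `tvDist_lweSamples_le` — close noise laws give close `LWE` samples:
  `Δ(A_{s,χ}, A_{s,χ'}) ≤ Δ(χ, χ')` and `Δ(A_{s,χ}^m, A_{s,χ'}^m) ≤ m Δ(χ, χ')` (kernel contraction and the
  iid hybrid bound of the tree);
* **`exists_gridRate_tvDist_lweSamples_le`** — for `0 < β ≤ α`, `N ≥ 1` and every `m`, some grid point
  `j ≤ N` gives a rate `α' = √(β² + jα²/N) ≥ α` with `Δ(A_{s,Ψ̄_{α'}}^m, A_{s,Ψ̄_α}^m) ≤ 2m/N`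
  (printed: `9 nᶜ · n^{-2c}` with `N = n^{2c}`, `m = nᶜ`), the samples being the tree's discretised
  `lweSamples (discretizedGaussian q ·) s m`. Adding independent `Ψ_{√γ_j}` noise to continuous
  `A_{s,Ψ_β}` samples produces exactly `A_{s,Ψ_{α'}}` (sum of independent Gaussians), which is how the
  reductions realise the rate `α'`; that exact-law step is not part of this file.

## References

* O. Regev, *On lattices, learning with errors, random linear codes, and cryptography*, J. ACM 56
  (2009), art. 34, Lemma 3.7 and its proof, Claim 2.2 (held: arXiv:2401.03703, p. 17).
* Z. Brakerski, A. Langlois, C. Peikert, O. Regev, D. Stehlé, *Classical hardness of learning with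
  errors*, STOC 2013, Def. 2.14, Lemma 2.15.
-/

noncomputable section

open scoped ENNReal

namespace Literature.Computability.Cryptography

namespace LWE

/-! ### The grid of rates -/

/-- The candidate rates of Regev's Lemma 3.7: `α'_j = √(β² + γ_j)` with `γ_j = j · α²/N` the points of
"the set of all integer multiples of `n^{-2c}α²` between `0` and `α²`" (`N = n^{2c}`, `0 ≤ j ≤ N`).
[cite: RegevLWE2009, Lemma 3.7 (proof)] -/
def gridRate (α β : ℝ) (N j : ℕ) : ℝ := Real.sqrt (β ^ 2 + j * (α ^ 2 / N))

/-- Every grid rate is at least `β` (in particular positive when `β` is). [folklore] -/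
theorem le_gridRate {α β : ℝ} (hβ : 0 ≤ β) (N j : ℕ) : β ≤ gridRate α β N j := by
  rw [gridRate]
  have h0 : 0 ≤ (j : ℝ) * (α ^ 2 / N) := by positivity
  calc β = Real.sqrt (β ^ 2) := (Real.sqrt_sq hβ).symm
    _ ≤ Real.sqrt (β ^ 2 + j * (α ^ 2 / N)) := Real.sqrt_le_sqrt (by linarith)

/-- **The grid step of Lemma 3.7**: for `0 < β ≤ α` and `N ≥ 1` some grid point `j ≤ N` satisfies
`α ≤ √(β² + jα²/N) ≤ (1 + 1/N) α` ("Consider the smallest `γ ∈ Z` such that `γ ≥ α² - β²`. Clearly,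
`γ ≤ α² - β² + n^{-2c}α²` … `α ≤ α' ≤ √(α² + n^{-2c}α²) ≤ (1 + n^{-2c})α`").
[cite: RegevLWE2009, Lemma 3.7 (proof)] -/
theorem exists_gridRate_between {α β : ℝ} (hβ : 0 < β) (hβα : β ≤ α) {N : ℕ} (hN : 0 < N) :
    ∃ j : ℕ, j ≤ N ∧ α ≤ gridRate α β N j ∧ gridRate α β N j ≤ (1 + 1 / N) * α := by
  classical
  have hα : 0 < α := lt_of_lt_of_le hβ hβα
  have hNr : (0 : ℝ) < N := by exact_mod_cast hN
  -- the set of admissible grid indices is nonempty (`j = N`)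
  have hex : ∃ j : ℕ, α ^ 2 ≤ β ^ 2 + j * (α ^ 2 / N) :=
    ⟨N, by rw [mul_div_cancel₀ _ hNr.ne']; nlinarith⟩
  refine ⟨Nat.find hex, ?_, ?_, ?_⟩
  · exact Nat.find_min' hex (show α ^ 2 ≤ β ^ 2 + (N : ℕ) * (α ^ 2 / N) by
      rw [mul_div_cancel₀ _ hNr.ne']; nlinarith)
  · -- `α ≤ α'`
    rw [gridRate]
    calc α = Real.sqrt (α ^ 2) := (Real.sqrt_sq hα.le).symm
      _ ≤ _ := Real.sqrt_le_sqrt (Nat.find_spec hex)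
  · -- `α' ≤ √(α² + α²/N) ≤ (1 + 1/N) α`
    have hlt : β ^ 2 + (Nat.find hex : ℕ) * (α ^ 2 / N) ≤ α ^ 2 + α ^ 2 / N := by
      rcases Nat.eq_zero_or_pos (Nat.find hex) with h0 | hpos
      · rw [h0, Nat.cast_zero, zero_mul, add_zero]
        have : 0 ≤ α ^ 2 / N := by positivity
        nlinarith
      · have hprev : ¬ α ^ 2 ≤ β ^ 2 + ((Nat.find hex - 1 : ℕ) : ℝ) * (α ^ 2 / N) :=
          Nat.find_min hex (Nat.sub_lt hpos one_pos)
        have hcast : ((Nat.find hex : ℕ) : ℝ) = ((Nat.find hex - 1 : ℕ) : ℝ) + 1 := by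
          rw [Nat.cast_sub (Nat.succ_le_of_lt hpos), Nat.cast_one]
          ring
        rw [hcast, add_mul, one_mul, ← add_assoc]
        linarith [not_le.1 hprev]
    rw [gridRate]
    calc Real.sqrt (β ^ 2 + (Nat.find hex : ℕ) * (α ^ 2 / N)) ≤ Real.sqrt (α ^ 2 + α ^ 2 / N) :=
          Real.sqrt_le_sqrt hlt
      _ ≤ (1 + 1 / N) * α := by
          rw [Real.sqrt_le_left (by positivity)]
          have h1 : 0 ≤ α ^ 2 / (N : ℝ) := by positivity
          have h2 : 0 ≤ α ^ 2 / (N : ℝ) / N := by positivity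
          have hsq : ((1 + 1 / N) * α) ^ 2 = α ^ 2 + 2 * (α ^ 2 / N) + α ^ 2 / N / N := by ring
          rw [hsq]
          linarith

/-! ### Close noise laws give close `LWE` samples -/

section Samples

variable {ι : Type} [Fintype ι] [DecidableEq ι] {R : Type} [CommRing R] [Fintype R]

/-- **`Δ(A_{s,χ}, A_{s,χ'}) ≤ Δ(χ, χ')`**: one sample is a fixed randomised function of the noise
(uniform `a`, then `(a, ⟨a, s⟩ + e)`), and randomised maps contract the statistical distance
(`tvDist_bind_le_of_forall_le`, `tvDist_map_le`). [cite: RegevLWE2009, Lemma 3.7 (proof)] -/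
theorem tvDist_lweSample_le_tvDist (χ χ' : PMF R) (s : ι → R) :
    (lweSample χ s).tvDist (lweSample χ' s) ≤ χ.tvDist χ' := by
  unfold lweSample
  exact PMF.tvDist_bind_le_of_forall_le _ _ _ fun a => PMF.tvDist_map_le_holds _ χ χ'

/-- **`Δ(A_{s,χ}^m, A_{s,χ'}^m) ≤ m · Δ(χ, χ')`** ("the statistical distance between `nᶜ` samples from
`Ψ_α` and `nᶜ` samples from `Ψ_{α'}` is at most `nᶜ` times …": the iid hybrid bound `tvDist_iidPMF_le`).
[cite: RegevLWE2009, Lemma 3.7 (proof)] -/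
theorem tvDist_lweSamples_le (χ χ' : PMF R) (s : ι → R) (m : ℕ) :
    (lweSamples χ s m).tvDist (lweSamples χ' s m) ≤ m * χ.tvDist χ' :=
  (tvDist_iidPMF_le _ _ m).trans (mul_le_mul_of_nonneg_left (tvDist_lweSample_le_tvDist χ χ' s) (Nat.cast_nonneg m))

end Samples

/-! ### Lemma 3.7, distributional part -/

/-- **Some grid rate is `2/N`-close to `Ψ̄_α`** (Claim 2.2 at the grid point of
`exists_gridRate_between`: `α ≤ α' ≤ (1 + 1/N)α ≤ 2α`, so `Δ(Ψ̄_{α'}, Ψ̄_α) ≤ 2(α'/α - 1) ≤ 2/N`; printed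
with Regev's constant: `9 n^{-2c}`). [cite: RegevLWE2009, Lemma 3.7 (proof) with Claim 2.2] -/
theorem exists_gridRate_tvDist_discretizedGaussian_le (q : ℕ) [NeZero q] {α β : ℝ} (hβ : 0 < β)
    (hβα : β ≤ α) {N : ℕ} (hN : 0 < N) :
    ∃ j : ℕ, j ≤ N ∧ α ≤ gridRate α β N j ∧
      (discretizedGaussian q (gridRate α β N j)).tvDist (discretizedGaussian q α) ≤ 2 / N := by
  obtain ⟨j, hjN, hαj, hjα⟩ := exists_gridRate_between hβ hβα hN
  have hα : 0 < α := lt_of_lt_of_le hβ hβα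
  have hNr : (1 : ℝ) ≤ N := by exact_mod_cast hN
  have h2 : gridRate α β N j ≤ 2 * α := by
    refine hjα.trans ?_
    have : 1 / (N : ℝ) ≤ 1 := by rw [div_le_one (by linarith)]; exact hNr
    nlinarith
  refine ⟨j, hjN, hαj, ?_⟩
  rw [PMF.tvDist_comm]
  refine (tvDist_discretizedGaussian_le q hα hαj h2).trans ?_
  have hdiv : gridRate α β N j / α ≤ 1 + 1 / N := by rwa [div_le_iff₀ hα]
  rw [div_eq_mul_one_div (2 : ℝ) (N : ℝ)]
  linarith

/-- **Regev 2009, Lemma 3.7 / BLPRS 2013, Lemma 2.15 — the distributional step, for `m` discretised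
samples.** For an unknown rate `0 < β ≤ α`, a grid size `N ≥ 1` and any number of samples `m`, some grid
point `j ≤ N` yields a rate `α' = √(β² + jα²/N) ≥ α` for which `m` samples of `A_{s,Ψ̄_{α'}}` are within
statistical distance `2m/N` of `m` samples of `A_{s,Ψ̄_α}`, for every secret `s` (printed:
`9 nᶜ n^{-2c} = 9n^{-c}` for `m = nᶜ`, `N = n^{2c}`). An oracle for the rate `α` run on the `α'`-samples
therefore behaves, on every event, as on genuine `α`-samples up to `2m/N`
(`PMF.abs_toReal_toOuterMeasure_sub_le_tvDist`). [cite: RegevLWE2009, Lemma 3.7] -/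
theorem exists_gridRate_tvDist_lweSamples_le {n : ℕ} (q : ℕ) [NeZero q] {α β : ℝ} (hβ : 0 < β)
    (hβα : β ≤ α) {N : ℕ} (hN : 0 < N) (m : ℕ) :
    ∃ j : ℕ, j ≤ N ∧ α ≤ gridRate α β N j ∧ ∀ s : Fin n → ZMod q,
      (lweSamples (discretizedGaussian q (gridRate α β N j)) s m).tvDist
          (lweSamples (discretizedGaussian q α) s m) ≤ 2 * m / N := by
  obtain ⟨j, hjN, hαj, hΔ⟩ := exists_gridRate_tvDist_discretizedGaussian_le q hβ hβα hN
  refine ⟨j, hjN, hαj, fun s => ?_⟩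
  refine (tvDist_lweSamples_le _ _ s m).trans ?_
  calc (m : ℝ) * (discretizedGaussian q (gridRate α β N j)).tvDist (discretizedGaussian q α)
      ≤ m * (2 / N) := mul_le_mul_of_nonneg_left hΔ (Nat.cast_nonneg m)
    _ = 2 * m / N := by ring

end LWE

end Literature.Computability.Cryptography

end
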